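import Mathlib
import Summits.Ventures.PercRepro2.CoinChainXAGeneralGate
import Summits.Ventures.PercRepro2.CoinChainReductionGen
import Summits.Ventures.PercRepro2.CoinChainHeadHyps

/-!
# Row 2′DARC at the general AND-switch chain with ONE sure entry and the entry markers — unconditional
(blind cell PercRepro2, night-2 g28; proofs/NIGHT2-DARC.md §69)

`darc_of_chain_six_general`: the general chain (`a` entered from the sure entry `m ∈ U` and from `a'` by the
coin, `a'` entered from `ent' ∋ j` surely; chain data `ν = P(level)`, `c = chainC`, `d = chainD`,
`d' = chainD'`; the markers are the entries `m` and `j`; an lsm core; positive world masses and ideal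
mass) satisfies `DARC pr arcs s {t} m j a w` — with NO sign condition and NO restriction on the gate:
`chain_darc_of_functional` with `chain_functional_nonneg_six_general_gate`.
-/

namespace Summit.Ventures.PercRepro2.Coin

open Classical

section GeneralGateDarc

variable {V : Type*} {E : Type*} [Fintype V] [DecidableEq V] [Fintype E] [DecidableEq E]
  {R : Type*} [Field R] [LinearOrder R] [IsStrictOrderedRing R]
  {arcs : E → Finset (V × V)} {s : V} {U : Finset V} {ent' : Finset V} {c' c : V → E}
  {a' a w : V}

/-- **ROW 2′DARC AT THE GENERAL AND-SWITCH CHAIN WITH ONE SURE ENTRY `m` AND THE ENTRY MARKERS `(m, j)`,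
`j ∈ ent'`** (chain data `ν = P(level)`, `c = chainC`, `d = chainD`, `d' = chainD'`, an lsm core, positive
world masses and ideal mass): `DARC pr arcs s {t} m j a w`, unconditionally. -/
theorem darc_of_chain_six_general (pr : E → R) (hp : IsProbVec pr) (hS : SameEnds arcs)
    (h' : OrTailK arcs s U ent' c' a') (hsure' : ∀ r ∈ ent', pr (c' r) = 1)
    {m j : V} (hj : j ∈ ent')
    (h : OrTailK arcs s (insert a' U) (insert a' {m}) c a) (hsure : pr (c m) = 1)
    (hm : m ∈ U) (hjU : j ∈ U)
    (hν : ∀ W W', W ⊆ U → W' ⊆ U →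
      prob pr (coreLevel arcs s U W) * prob pr (coreLevel arcs s U W') ≤
        prob pr (coreLevel arcs s U (W ∩ W')) * prob pr (coreLevel arcs s U (W ∪ W')))
    {t : V} (htC : t ∉ insert a (insert a' U)) (hts : t ≠ s) (hws : w ≠ s)
    (hwC : w ∉ insert a (insert a' U))
    (hpos0 : 0 < ∑ W ∈ U.powerset, prob pr (coreLevel arcs s U W) *
      chainMix {m} ent' 0 (chainC pr arcs s t U ent' a' a) (chainD pr arcs s t U ent' a' a) W)
    (hpos1 : 0 < ∑ W ∈ U.powerset, prob pr (coreLevel arcs s U W) *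
      chainMix {m} ent' 1 (chainC pr arcs s t U ent' a' a) (chainD pr arcs s t U ent' a' a) W)
    (hmI : 0 < ∑ W ∈ U.powerset.filter (fun W => ¬ ∃ r ∈ ({m} : Finset V) ∪ ent', r ∈ W),
      prob pr (coreLevel arcs s U W) * chainC pr arcs s t U ent' a' a W) :
    DARC pr arcs s {t} m j a w := by
  obtain ⟨hA0, hAmono, hAlsm⟩ := OrTailU.head_props (U := insert a' U) (a := a) pr hp hS t
  obtain ⟨hdc, hd'd, hcc, hdd, hd'd', hdd', hratio, hratio', -, hcd, hcd'⟩ :=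
    chainPhi_head_hyps (fun X => prob pr (coreAvoidEvent arcs s t (insert a (insert a' U)) X))
      ent' a' a w hA0 hAmono hAlsm
  have hsureM : ∀ r ∈ ({m} : Finset V), pr (c r) = 1 := by
    intro r hr
    rw [Finset.mem_singleton] at hr
    rw [hr]; exact hsure
  have hentU : ({m} : Finset V) ⊆ U := Finset.singleton_subset_iff.2 hm
  refine chain_darc_of_functional pr hS h' hsure' h hsureM hentU hm hjU htC hts hws hwC ?_
  exact chain_functional_nonneg_six_general_gate U m j ent' hj (fun W => prob pr (coreLevel arcs s U W))
    (chainC pr arcs s t U ent' a' a) (chainD pr arcs s t U ent' a' a) (chainD' pr arcs s t U ent' a' a w)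
    (pr (c a')) (hp.nonneg _) (hp.le_one _) (fun W => prob_nonneg hp _)
    (fun s' hs' t' ht' => hν s' t' hs' ht') (fun W => hA0 _) (fun W => hA0 _) (fun W => hA0 _)
    hdc (fun W => le_trans (hd'd W) (hdc W)) hd'd hcc hdd hd'd' hcd hcd' hdd' hratio hratio'
    (fun W => if m ∈ W then (1 : R) else 0) (fun W => if j ∈ W then (1 : R) else 0)
    (fun W => rfl) (fun W => rfl) hpos0 hpos1 hmI

end GeneralGateDarc

end Summit.Ventures.PercRepro2.Coin
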